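import Mathlib
import HarnessLib
import Summits.NavierStokesRegularity.NavierStokesRegularity.Theorems.HalfSpaceWindowDoorCirculationCarryingRigidityDefs
import Summits.NavierStokesRegularity.NavierStokesRegularity.Theorems.HalfSpaceWindowDoorCirculationCarryingRigidityReduction
import Summits.NavierStokesRegularity.NavierStokesRegularity.Theorems.HalfSpaceWindowDoorCirculationCarryingRigidityCriticalStretchingAnalytic
import Summits.NavierStokesRegularity.NavierStokesRegularity.Theorems.HalfSpaceWindowDoorCirculationCarryingRigidityWindowedFlux
import Literature.Analysis.UnboundedOperators.HeatKernelBoundedData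
import Literature.Analysis.FluidPDE.AxisymNoSwirlVorticity
import Summits.NavierStokesRegularity.NavierStokesRegularity.Theorems.HalfSpaceWindowDoorCirculationCarryingRigidityPlaneFluxDynamics
import Summits.NavierStokesRegularity.NavierStokesRegularity.Theorems.HalfSpaceWindowDoorCirculationCarryingRigidityTiltingIdentity
import Summits.NavierStokesRegularity.NavierStokesRegularity.Theorems.HalfSpaceWindowDoorCirculationCarryingRigidityTiltingFlux
import Literature.Analysis.UnboundedOperators.HeatKernelHeatEquation
import Literature.Analysis.UnboundedOperators.HeatFlowCalculus
import Literature.Analysis.UnboundedOperators.HeatExtensionHarnack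
import Literature.Analysis.UnboundedOperators.HeatKernelGradient
import Literature.Analysis.UnboundedOperators.HeatKernelReversePoincare
import Literature.Analysis.FluidPDE.AxisymNoSwirlImpulseSlice
import Literature.Analysis.FluidPDE.AxisymHouLiVariables
import Literature.Analysis.Calculus.IicRpowTails
import Literature.Analysis.FluidPDE.ConstantinFeffermanStretching
import Summits.NavierStokesRegularity.NavierStokesRegularity.Theorems.PoloidalWindowDoorPoloidalWindowRigidityScrewKinematics
import Summits.NavierStokesRegularity.NavierStokesRegularity.Theorems.HalfSpaceWindowDoorCirculationCarryingRigidityGaussKernel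
import Summits.NavierStokesRegularity.NavierStokesRegularity.Theorems.HalfSpaceWindowDoorCirculationCarryingRigidityGaussCirculation
import Summits.NavierStokesRegularity.NavierStokesRegularity.Theorems.HalfSpaceWindowDoorCirculationCarryingRigidityGaussStein
import Summits.NavierStokesRegularity.NavierStokesRegularity.Theorems.HalfSpaceWindowDoorCirculationCarryingRigidityGaussTilting
import Summits.NavierStokesRegularity.NavierStokesRegularity.Theorems.HalfSpaceWindowDoorCirculationCarryingRigidityGaussVorticityLaw
import Summits.NavierStokesRegularity.NavierStokesRegularity.Theorems.HalfSpaceWindowDoorCirculationCarryingRigidityGaussSwirlLaw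

/-!
# Route `HalfSpaceWindowDoor`, crux `CirculationCarryingRigidity` (stmt-NavierStokesRegularity-25311) — line «gauss-swirl»,
# part `GaussRepresentation`: the EXACT REPRESENTATION «Gaussian circulation = accumulated past inflow»
`𝒢(s₁)/(s₀−s₁) = −½∫_{(−∞,s₁]} ℐ(σ)(s₀−σ)^{−2}dσ` (`gaussAngMom_eq_integral_inflow(_holds)`, sign-free, every door-class profile,
every space–time axis), its closed-hemisphere reading `integral_inflow_nonpos(_holds)`, stratum **R⁺ PROVED**
(`accumulatedInflowStratum_holds`, `noInflowStratum_of_accumulated : R⁺ ⇒ R`), stratum **R′ PROVED** (`coSignedStratum_holds`), and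
`persistentAxis_iff_hemisphereLiouvilleE3 : PersistentAxis ↔ HemisphereLiouvilleE3` (K1 is EXACTLY wall-strength)

LINE «gauss-swirl» = ideator ns-idea-4 g11 (D-0145, files-only; critic of record idea-crit-3: PASS, grade new-combination on the wall W6
`…Defs.HemisphereLiouvilleE3`), file of record `pub/ideators/ns-idea-4/lines/gauss-swirl/GaussSwirl_v1_4.lean` (sha16 9f36760ac8cb3b0a,
`lean check` rc 0, sorries 1 = the research statement K1 only), card `LINE-gauss-swirl_v1_4.md`, PORT-MAP.md 5a0f471fb69fa47f.  PORTED
INTO THE TREE by the LEAD of 25311 (ns-hsw-p1 g6, cell pub-ns-dss) as census support `--supports stmt-NavierStokesRegularity-25311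
--as helper`: the proof texts below are the ideator's, VERBATIM modulo the split into ≤ 400-line modules, the `E3 ↦ EuclideanSpace ℝ
(Fin 3)` spelling, the namespace, added one-line docstrings and two `_`-renamings for the unused-variable linter; the vocabulary
(`InDoorClass`, `SignE3`, `gauss`, `angMom`, `gaussAngMom` = 𝒢, `gaussInflow` = ℐ, and the obligation / stratum Props) lives in
`…CirculationCarryingRigidityDefs`.

THE LINE IN ONE PARAGRAPH.  2D one-signed vorticity has the exact law `d/dt∫|x|²ω = 4νΦ`, which alone kills ancient flows with `Φ > 0`;
in the 3D closed hemisphere (`ω₃ ≥ 0`) it survives for the GAUSSIAN AXIAL ANGULAR MOMENTUM `𝒢(t;x₀) = t^{-3/2}∫e^{−|x−x₀|²/4t} g`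
(`= 2t^{-1/2}∫e^{…}ω₃ ≥ 0`), because against the divergence-free Gaussian swirl field `K_t(x−x₀)·e₃×(x−x₀)` pressure AND vortex tilting
drop out exactly, leaving ONE signed residue, the inflow correlation `ℐ = t^{-3/2}∫e^{…}((x−x₀)·v) g`: `d𝒢/ds = −𝒢/(s₀−s) − ℐ/(2(s₀−s))`;
with the time-only Type-I rate `𝒢/(s₀−s) → 0` in the far past, so «no inflow about ONE space–time axis before some epoch ⇒ poloidal».

WHAT THIS IS NOT: not a statement about Navier–Stokes regularity (Clay A).  The door statements are regularity CRITERIA about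
HYPOTHETICAL blow-up profiles (KNSS ancient mild solutions); the research statement K1 `PersistentAxis` (⟺ the wall) is NOT proved,
NOT registered and nothing is closed by this file; item 25311 stays OPEN at its research stub.
-/

noncomputable section

-- the summit and its single sub-problem share the name (CONVENTIONS §1), as in every Theorems file
set_option linter.dupNamespace false

namespace Summit.NavierStokesRegularity.NavierStokesRegularity.Theorems.HalfSpaceWindowDoorCirculationCarryingRigidityGaussRepresentation


open scoped BigOperators Topology MeasureTheory InnerProductSpace RealInnerProductSpace Laplacian ContDiff
open Filter Set Function MeasureTheory Metric
open Literature.Analysis Literature.Analysis.FluidPDE Literature.Analysis.UnboundedOperators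
open Summit.NavierStokesRegularity.NavierStokesRegularity.Theses.HalfSpaceWindowDoor
open Summit.NavierStokesRegularity.NavierStokesRegularity.Theorems.HalfSpaceWindowDoorCirculationCarryingRigidityDefs
open Summit.NavierStokesRegularity.NavierStokesRegularity.Theorems.HalfSpaceWindowDoorCirculationCarryingRigidityReduction
  (circulationCarryingRigidity_of_hemisphereLiouvilleE3)
open Summit.NavierStokesRegularity.NavierStokesRegularity.Theorems.HalfSpaceWindowDoorCirculationCarryingRigidityCriticalStretchingAnalytic
  (inner_curl_e3_eq_zero_of_far_past)
open Summit.NavierStokesRegularity.NavierStokesRegularity.Theorems.LocalSineTubeDoorProfileAlignedWindowRigidityAncient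
  (bdd_of_hasTypeITimeDecay analyticOnNhd_slice)
open Summit.NavierStokesRegularity.NavierStokesRegularity.Theorems.PoloidalWindowDoorPoloidalWindowRigidityClassSpaceTimeRates
  (exists_fderiv_rate_of_class' exists_iteratedFDeriv_two_rate_of_class' exists_iteratedFDeriv_three_rate_of_class)
open Summit.NavierStokesRegularity.NavierStokesRegularity.Theorems.HalfSpaceWindowDoorCirculationCarryingRigidityPlaneFluxDynamics
  (hasDerivAt_inner_curl_e3_convect)
open Summit.NavierStokesRegularity.NavierStokesRegularity.Theorems.HalfSpaceWindowDoorCirculationCarryingRigidityTiltingIdentity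
  (convect_sub_stretch_two_eq_divh)
open Summit.NavierStokesRegularity.NavierStokesRegularity.Theorems.HalfSpaceWindowDoorCirculationCarryingRigidityTiltingFlux
  (contDiff_flux norm_flux_le norm_fderiv_flux_le)
open Summit.NavierStokesRegularity.NavierStokesRegularity.Theorems.HalfSpaceWindowDoorCirculationCarryingRigiditySubcriticalStretching
  (hasDerivAt_inner_curl_e3 fderiv_inner_e3_apply laplacian_inner_e3)
open Summit.NavierStokesRegularity.NavierStokesRegularity.Theorems.HalfSpaceWindowDoorCirculationCarryingRigidityPlaneFluxHeightWindow
  (abs_inner_e3_le contDiff_one_curl)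
open Summit.NavierStokesRegularity.NavierStokesRegularity.Theorems.HalfSpaceWindowDoorCirculationCarryingRigidityPlaneLaplacian
  (contDiff_two_curl norm_iteratedFDeriv_two_inner_e3_le)
open Summit.NavierStokesRegularity.NavierStokesRegularity.Theorems.ChiralWindowDoorClassDerivDecay (exists_classical_of_class)
open Summit.NavierStokesRegularity.NavierStokesRegularity.Theorems.PoloidalWindowDoorPoloidalWindowRigidityScrewKinematics (inner_eq_three)
open Summit.NavierStokesRegularity.NavierStokesRegularity.Theorems.HalfSpaceWindowDoorCirculationCarryingRigidityGaussKernel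
open Summit.NavierStokesRegularity.NavierStokesRegularity.Theorems.HalfSpaceWindowDoorCirculationCarryingRigidityGaussCirculation
open Summit.NavierStokesRegularity.NavierStokesRegularity.Theorems.HalfSpaceWindowDoorCirculationCarryingRigidityGaussStein
open Summit.NavierStokesRegularity.NavierStokesRegularity.Theorems.HalfSpaceWindowDoorCirculationCarryingRigidityGaussTilting
open Summit.NavierStokesRegularity.NavierStokesRegularity.Theorems.HalfSpaceWindowDoorCirculationCarryingRigidityGaussVorticityLaw
open Summit.NavierStokesRegularity.NavierStokesRegularity.Theorems.HalfSpaceWindowDoorCirculationCarryingRigidityGaussSwirlLaw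

/-- The quotient `h(σ) = 𝒢(σ)/(s₀−σ)` obeys `h' = −ℐ/(2(s₀−σ)²)` (from O1). -/
theorem hasDerivAt_quot (h1 : GaussianSwirlLaw) {C : ℝ} {v : ℝ → (EuclideanSpace ℝ (Fin 3)) → (EuclideanSpace ℝ (Fin 3))} (hv : InDoorClass C v) (x₀ : (EuclideanSpace ℝ (Fin 3)))
    {s₀ s : ℝ} (hs : s < 0) (hs₀ : s < s₀) :
    HasDerivAt (fun σ => gaussAngMom (s₀ - σ) x₀ (v σ) / (s₀ - σ))
      (-(gaussInflow (s₀ - s) x₀ (v s)) / (2 * (s₀ - s) ^ 2)) s := by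
  have hd : HasDerivAt (fun τ : ℝ => s₀ - τ) (-1) s := by
    simpa using (hasDerivAt_id s).const_sub s₀
  have hne : (s₀ - s) ≠ 0 := (sub_pos.2 hs₀).ne'
  have hq := (h1 C v hv x₀ s₀ s hs hs₀).div hd hne
  have hval : ((-(gaussAngMom (s₀ - s) x₀ (v s)) / (s₀ - s) - gaussInflow (s₀ - s) x₀ (v s) / (2 * (s₀ - s)))
        * (s₀ - s) - gaussAngMom (s₀ - s) x₀ (v s) * -1) / (s₀ - s) ^ 2
      = -(gaussInflow (s₀ - s) x₀ (v s)) / (2 * (s₀ - s) ^ 2) := by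
    field_simp
    ring
  exact hq.congr_deriv hval

/-- **THE REPRESENTATION (sign-free; every door-class profile, every space–time axis).**
`𝒢(s₁)/(s₀−s₁) = −½ ∫_{(−∞,s₁]} ℐ(σ)(s₀−σ)^{−2} dσ`, the integral absolutely convergent: the Gaussian angular momentum at
an epoch IS the accumulated, parabolically weighted Gaussian-mean angular-momentum inflow over the whole past
(fundamental theorem of calculus on `(−∞, s₁]` for `h = 𝒢/(s₀−σ)`, `h' = −ℐ/(2(s₀−σ)²)`, `h → 0` by O3, integrability from
`abs_gaussInflow_le`). -/
theorem gaussAngMom_eq_integral_inflow (h1 : GaussianSwirlLaw) (h3 : GaussianBound) {C : ℝ} {v : ℝ → (EuclideanSpace ℝ (Fin 3)) → (EuclideanSpace ℝ (Fin 3))}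
    (hv : InDoorClass C v) (x₀ : (EuclideanSpace ℝ (Fin 3))) {s₀ s₁ : ℝ} (hs₁ : s₁ < 0) (hs₁₀ : s₁ < s₀) :
    IntegrableOn (fun σ => gaussInflow (s₀ - σ) x₀ (v σ) / (s₀ - σ) ^ 2) (Iic s₁) ∧
    gaussAngMom (s₀ - s₁) x₀ (v s₁) / (s₀ - s₁)
      = -(1 / 2) * ∫ σ in Iic s₁, gaussInflow (s₀ - σ) x₀ (v σ) / (s₀ - σ) ^ 2 := by
  set h : ℝ → ℝ := fun σ => gaussAngMom (s₀ - σ) x₀ (v σ) / (s₀ - σ) with hh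
  set F : ℝ → ℝ := fun σ => gaussInflow (s₀ - σ) x₀ (v σ) / (s₀ - σ) ^ 2 with hF
  have hder : ∀ σ ∈ Iic s₁, HasDerivAt h (-(1 / 2) * F σ) σ := by
    intro σ hσ
    have hσ0 : σ < 0 := lt_of_le_of_lt hσ hs₁
    have hσs₀ : σ < s₀ := lt_of_le_of_lt hσ hs₁₀
    have := hasDerivAt_quot h1 hv x₀ hσ0 hσs₀
    refine this.congr_deriv ?_
    rw [show F σ = gaussInflow (s₀ - σ) x₀ (v σ) / (s₀ - σ) ^ 2 from rfl]
    have hne : (s₀ - σ) ≠ 0 := (sub_pos.2 hσs₀).ne'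
    field_simp
  -- measurability of `F` on `(−∞, s₁]`: it is `−2·(deriv h)` there
  have hmeas : AEStronglyMeasurable F (volume.restrict (Iic s₁)) := by
    refine (((measurable_deriv h).const_mul (-2)).aestronglyMeasurable).congr ?_
    refine (ae_restrict_iff' measurableSet_Iic).2 (ae_of_all _ fun σ hσ => ?_)
    show -2 * deriv h σ = F σ
    rw [(hder σ hσ).deriv]
    ring
  -- the majorant `(A/κ)(−σ)^{−2}`
  have ht₁0 : 0 < s₀ - s₁ := by linarith
  set κ : ℝ := (s₀ - s₁) / ((s₀ - s₁) - s₁) with hκ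
  have hκden : 0 < (s₀ - s₁) - s₁ := by linarith
  have hκ0 : 0 < κ := div_pos ht₁0 hκden
  have hκ1 : κ ≤ 1 := by rw [hκ, div_le_one hκden]; linarith
  have hκs₁ : κ * (-s₁) ≤ s₀ - s₁ := by
    rw [hκ, div_mul_eq_mul_div, div_le_iff₀ hκden]
    nlinarith
  have hlow : ∀ σ, σ ≤ s₁ → κ * (-σ) ≤ s₀ - σ := by
    intro σ hσ
    have : κ * (s₁ - σ) ≤ s₁ - σ := by nlinarith
    nlinarith
  set A : ℝ := (4 * Real.pi) ^ ((3 : ℝ) / 2) * (12 * C ^ 2) with hA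
  have hA0 : 0 ≤ A := by positivity
  have hbound : ∀ σ, σ ≤ s₁ → |F σ| ≤ A / κ * (-σ) ^ (-(2 : ℝ)) := by
    intro σ hσ
    have hσ0 : 0 < -σ := by linarith
    have htσ : 0 < s₀ - σ := by linarith
    have hI := abs_gaussInflow_le hv x₀ htσ (by linarith : σ < 0)
    have hFσ : F σ = gaussInflow (s₀ - σ) x₀ (v σ) / (s₀ - σ) ^ 2 := rfl
    rw [hFσ, abs_div, abs_of_pos (pow_pos htσ 2), div_le_iff₀ (pow_pos htσ 2)]
    have hr : (-σ) ^ (-(2 : ℝ)) = ((-σ) ^ 2)⁻¹ := by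
      rw [Real.rpow_neg hσ0.le, Real.rpow_two]
    rw [hr]
    calc |gaussInflow (s₀ - σ) x₀ (v σ)| ≤ A * ((s₀ - σ) / (-σ)) := hI
      _ = A / κ * ((-σ) ^ 2)⁻¹ * ((κ * (-σ)) * (s₀ - σ)) := by
          field_simp
      _ ≤ A / κ * ((-σ) ^ 2)⁻¹ * ((s₀ - σ) * (s₀ - σ)) := by
          apply mul_le_mul_of_nonneg_left _ (by positivity)
          exact mul_le_mul_of_nonneg_right (hlow σ hσ) htσ.le
      _ = A / κ * ((-σ) ^ 2)⁻¹ * (s₀ - σ) ^ 2 := by ring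
  have hmajI : IntegrableOn (fun y : ℝ => A / κ * (-y) ^ (-(2 : ℝ))) (Iic s₁) := by
    have hgI : IntegrableOn (fun x : ℝ => A / κ * x ^ (-(2 : ℝ))) (Ioi (-s₁)) :=
      (integrableOn_Ioi_rpow_of_lt (by norm_num) (by linarith)).const_mul _
    have hgI' : IntegrableOn (fun x : ℝ => A / κ * x ^ (-(2 : ℝ))) (Ici (-s₁)) :=
      (integrableOn_Ici_iff_integrableOn_Ioi enorm_ne_top).2 hgI
    rw [Literature.Analysis.Calculus.integrableOn_Iic_iff_comp_neg]
    simpa only [neg_neg] using hgI'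
  have hint : IntegrableOn F (Iic s₁) :=
    Integrable.mono' hmajI hmeas ((ae_restrict_iff' measurableSet_Iic).2
      (ae_of_all _ fun σ hσ => by rw [Real.norm_eq_abs]; exact hbound σ hσ))
  -- the limit at `−∞`
  obtain ⟨B, s₂, -, -, hB⟩ := h3 C v hv x₀ s₀
  have htend : Tendsto h atBot (𝓝 0) := by
    have hden : Tendsto (fun σ : ℝ => s₀ - σ) atBot atTop := by
      have := tendsto_atTop_add_const_left atBot s₀ tendsto_neg_atBot_atTop
      simpa [sub_eq_add_neg] using this
    have hmaj : Tendsto (fun σ : ℝ => B / (s₀ - σ)) atBot (𝓝 0) := tendsto_const_nhds.div_atTop hden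
    refine squeeze_zero_norm' ?_ hmaj
    filter_upwards [eventually_lt_atBot (min s₂ s₁)] with σ hσ
    have hσ2 : σ < s₂ := lt_of_lt_of_le hσ (min_le_left _ _)
    have hσ1 : σ < s₁ := lt_of_lt_of_le hσ (min_le_right _ _)
    have htσ : 0 < s₀ - σ := by linarith
    rw [hh]
    simp only
    rw [Real.norm_eq_abs, abs_div, abs_of_pos htσ]
    exact div_le_div_of_nonneg_right (hB σ hσ2) htσ.le
  have hFTC := integral_Iic_of_hasDerivAt_of_tendsto' hder (hint.const_mul (-(1 / 2))) htend
  refine ⟨hint, ?_⟩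
  rw [integral_const_mul, sub_zero] at hFTC
  exact hFTC.symm

/-- **Accumulated inflow is non-positive in the closed hemisphere**, and vanishes at an epoch iff that slice is poloidal. -/
theorem integral_inflow_nonpos (h1 : GaussianSwirlLaw) (h2 : GaussianCirculation) (h3 : GaussianBound)
    {C : ℝ} {v : ℝ → (EuclideanSpace ℝ (Fin 3)) → (EuclideanSpace ℝ (Fin 3))} (hv : InDoorClass C v) (hsign : SignE3 v) (x₀ : (EuclideanSpace ℝ (Fin 3))) {s₀ s₁ : ℝ}
    (hs₁ : s₁ < 0) (hs₁₀ : s₁ < s₀) :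
    (∫ σ in Iic s₁, gaussInflow (s₀ - σ) x₀ (v σ) / (s₀ - σ) ^ 2) ≤ 0 ∧
    ((∫ σ in Iic s₁, gaussInflow (s₀ - σ) x₀ (v σ) / (s₀ - σ) ^ 2) = 0 → ∀ y, ⟪curl (v s₁) y, e3⟫_ℝ = 0) := by
  obtain ⟨-, hrep⟩ := gaussAngMom_eq_integral_inflow h1 h3 hv x₀ hs₁ hs₁₀
  have ht₁ : 0 < s₀ - s₁ := by linarith
  obtain ⟨hG0, hGz⟩ := h2 C v hv hsign x₀ (s₀ - s₁) s₁ ht₁ hs₁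
  have hq : 0 ≤ gaussAngMom (s₀ - s₁) x₀ (v s₁) / (s₀ - s₁) := div_nonneg hG0 ht₁.le
  refine ⟨by linarith, fun hzero => hGz ?_⟩
  rw [hzero, mul_zero] at hrep
  rcases div_eq_zero_iff.1 hrep with h | h
  · exact h
  · exact absurd h ht₁.ne'

/-- R⁺ from O1–O3: accumulated non-negative inflow on a ray forces a poloidal profile. -/
theorem accumulatedInflowStratum_of (h1 : GaussianSwirlLaw) (h2 : GaussianCirculation) (h3 : GaussianBound) :
    AccumulatedInflowStratum := by
  intro C v hv hsign x₀ s₀ s₁ hs₁ hs₁₀ hacc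
  have hfar : ∀ τ < s₁, ∀ y, ⟪curl (v τ) y, e3⟫_ℝ = 0 := by
    intro τ hτ
    obtain ⟨hle, hz⟩ := integral_inflow_nonpos h1 h2 h3 hv hsign x₀ (lt_trans hτ hs₁) (lt_trans hτ hs₁₀)
    exact hz (le_antisymm hle (hacc τ hτ))
  exact inner_curl_e3_eq_zero_of_far_past hv.1 hv.2.1 hv.2.2.1 hs₁ hfar

/-- `R⁺ ⇒ R`: pointwise non-negative inflow on a ray makes every accumulated integral non-negative. -/
theorem noInflowStratum_of_accumulated (hR : AccumulatedInflowStratum) : NoInflowStratum := by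
  intro C v hv hsign x₀ s₀ s₁ hs₁ hs₁₀ hI
  refine hR C v hv hsign x₀ s₀ s₁ hs₁ hs₁₀ fun s hs => ?_
  refine setIntegral_nonneg measurableSet_Iic fun σ hσ => ?_
  exact div_nonneg (hI σ (lt_of_le_of_lt hσ hs)) (sq_nonneg _)

/-- R′ from R: pointwise co-signed radial velocity and swirl give non-negative Gaussian inflow. -/
theorem coSignedStratum_of (hR : NoInflowStratum) : CoSignedStratum := by
  intro C v hv hsign x₀ s₀ s₁ hs₁ hs₁₀ hco
  refine hR C v hv hsign x₀ s₀ s₁ hs₁ hs₁₀ fun s hs => ?_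
  unfold gaussInflow
  refine mul_nonneg (Real.rpow_nonneg (by linarith) _) (integral_nonneg fun x => ?_)
  exact mul_nonneg (Real.exp_pos _).le (hco s hs x)

/-- **v1.3 PROVED:** the representation for every door-class profile (O1, O3 discharged by `gaussianSwirlLaw_holds`, `gaussianBound_holds`). -/
theorem gaussAngMom_eq_integral_inflow_holds {C : ℝ} {v : ℝ → (EuclideanSpace ℝ (Fin 3)) → (EuclideanSpace ℝ (Fin 3))} (hv : InDoorClass C v) (x₀ : (EuclideanSpace ℝ (Fin 3))) {s₀ s₁ : ℝ}
    (hs₁ : s₁ < 0) (hs₁₀ : s₁ < s₀) :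
    IntegrableOn (fun σ => gaussInflow (s₀ - σ) x₀ (v σ) / (s₀ - σ) ^ 2) (Iic s₁) ∧
    gaussAngMom (s₀ - s₁) x₀ (v s₁) / (s₀ - s₁)
      = -(1 / 2) * ∫ σ in Iic s₁, gaussInflow (s₀ - σ) x₀ (v σ) / (s₀ - σ) ^ 2 :=
  gaussAngMom_eq_integral_inflow gaussianSwirlLaw_holds gaussianBound_holds hv x₀ hs₁ hs₁₀

/-- **v1.3 PROVED:** in the closed hemisphere the accumulated weighted inflow about EVERY axis at EVERY epoch is `≤ 0`,
with equality iff the slice is poloidal. -/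
theorem integral_inflow_nonpos_holds {C : ℝ} {v : ℝ → (EuclideanSpace ℝ (Fin 3)) → (EuclideanSpace ℝ (Fin 3))} (hv : InDoorClass C v) (hsign : SignE3 v) (x₀ : (EuclideanSpace ℝ (Fin 3)))
    {s₀ s₁ : ℝ} (hs₁ : s₁ < 0) (hs₁₀ : s₁ < s₀) :
    (∫ σ in Iic s₁, gaussInflow (s₀ - σ) x₀ (v σ) / (s₀ - σ) ^ 2) ≤ 0 ∧
    ((∫ σ in Iic s₁, gaussInflow (s₀ - σ) x₀ (v σ) / (s₀ - σ) ^ 2) = 0 → ∀ y, ⟪curl (v s₁) y, e3⟫_ℝ = 0) :=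
  integral_inflow_nonpos gaussianSwirlLaw_holds gaussianCirculation_holds gaussianBound_holds hv hsign x₀ hs₁ hs₁₀

/-- **v1.3 PROVED: stratum R⁺** (accumulated inflow; contains R). -/
theorem accumulatedInflowStratum_holds : AccumulatedInflowStratum :=
  accumulatedInflowStratum_of gaussianSwirlLaw_holds gaussianCirculation_holds gaussianBound_holds

/-- **v1.3 PROVED: stratum R′** (co-signed radial velocity and swirl; pointwise hypothesis). -/
theorem coSignedStratum_holds : CoSignedStratum :=
  coSignedStratum_of noInflowStratum_holds

/-- **W6 ⇒ K1 (v1.4, PROVED): the research statement is EXACTLY wall-strength.**  If every closed-hemisphere profile is poloidal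
then about the axis `(x₀, s₀) = (0, 0)` the Gaussian angular momentum vanishes identically, hence (O1) so does the inflow
correlation: `ℐ ≡ 0 ≥ 0`. -/
theorem persistentAxis_of_hemisphereLiouvilleE3 (h : HemisphereLiouvilleE3) : PersistentAxis := by
  intro C v hv hsign
  refine ⟨0, 0, -1, by norm_num, by norm_num, fun s hs => ?_⟩
  have hs0 : s < 0 := by linarith
  have hω : ∀ σ < 0, ∀ y, ⟪curl (v σ) y, e3⟫_ℝ = 0 := h C v hv.1 hv.2.1 hv.2.2.1 hv.2.2.2 hsign
  have hG : ∀ σ < 0, gaussAngMom (0 - σ) 0 (v σ) = 0 := fun σ hσ => by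
    rw [gaussAngMom_eq_of_class hv 0 (by linarith) hσ]
    simp [hω σ hσ]
  have h1 := gaussianSwirlLaw_holds C v hv 0 0 s hs0 (by linarith)
  have hzero : HasDerivAt (fun σ => gaussAngMom (0 - σ) 0 (v σ)) 0 s := by
    have hev : (fun σ => gaussAngMom (0 - σ) 0 (v σ)) =ᶠ[𝓝 s] fun _ => (0 : ℝ) := by
      filter_upwards [Iio_mem_nhds hs0] with σ hσ using hG σ hσ
    exact (hasDerivAt_const s (0 : ℝ)).congr_of_eventuallyEq hev
  have huniq := h1.unique hzero
  rw [hG s hs0, neg_zero, zero_div, zero_sub, neg_eq_zero] at huniq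
  have ht2 : (2 * (0 - s)) ≠ 0 := by
    have : 0 < 2 * (0 - s) := by linarith
    exact this.ne'
  rcases div_eq_zero_iff.1 huniq with h0 | h0
  · rw [h0]
  · exact absurd h0 ht2

/-- **K1 ⟺ W6 (v1.4, kernel-checked).**  `PersistentAxis` is equivalent to the wall `HemisphereLiouvilleE3`: the line's single
research stub is neither weaker nor stronger than the wall — exactly as declared since v1. -/
theorem persistentAxis_iff_hemisphereLiouvilleE3 : PersistentAxis ↔ HemisphereLiouvilleE3 :=
  ⟨hemisphereLiouvilleE3_of_persistentAxis, persistentAxis_of_hemisphereLiouvilleE3⟩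

end Summit.NavierStokesRegularity.NavierStokesRegularity.Theorems.HalfSpaceWindowDoorCirculationCarryingRigidityGaussRepresentation

end
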